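import Mathlib
import HarnessLib
import HarnessLib.Audit
import Summits.PneNP.Statement
import Literature.ModelTheory.FiniteModelTheory.CPTCardProgram
import Literature.ModelTheory.FiniteModelTheory.CountingWidth
import Literature.Computability.Complexity.KarpProblems
import Literature.Computability.Complexity.CookBridges
import HarnessLib.Audit.Status.Attr

/-!
Route: ChoicelessCapture

DORMANT since 2026-08-23T22:08:25Z (reconciler: no traction for 6.3 d (last activity item-evidence-added at 2026-08-17T14:43:26Z); parked, not closed — `ledger route dormant route-PneNP-ChoicelessCapture --off` to reactivate) — unstaffed, not closed; items shared with open routes are served there. `ledger route dormant <id> --off` reactivates.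

# Route ChoicelessCapture — choiceless polynomial time captures P, and Hamiltonicity is not
choiceless

It suffices to show X = X₁ ∧ X₂ (RESURRECT-2001: the closing alternative (α) of the earlier
programme's unfinished route
pnp/routes/sat-vs-choiceless-polynomial-time, "separating NP from ever larger isomorphism-invariant
logics inside P … closed by a
capturing theorem", re-typed crux-only into today's Statement over the tree's Blass–Gurevich–Shelah
machines). X₁ (ChoicelessCapturesP,
the Blass–Gurevich–Shelah question, BGS 1999 §1 / 2002 §7 "the main problem, which remains open";
Grohe 2008 Problem 4): CHOICELESS
POLYNOMIAL TIME WITH COUNTING CAPTURES P ON FINITE GRAPHS — every isomorphism-closed polynomial-time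
class of finite graphs is decided by a
PTime-bounded BGS program with `Card` over HF(Fin n) (tree construction `CPTCardProgram`,
`CPTCardDefinable`; interface-free form of
`IsCPTCard.capturesPTIME_iff`). X₂ (HamNotChoiceless, Grohe 2008 Problem 4 remark "find a query in
NP that is not definable in CPT+C";
Dawar–Richerby–Rossman 2008 §10): the class of HAMILTONIAN finite graphs is not CPT+Card-definable.
No card is realised; nearest cards
symmetric-hidden-order-window, grohe-absolute-walls-w-not-a (both on the non-capture side).
Lean: `(∀ C : Set Literature.ModelTheory.FiniteModelTheory.FinGraph,
Literature.ModelTheory.FiniteModelTheory.IsIsoClosed C →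
Literature.ModelTheory.FiniteModelTheory.IsPTIMEClass C →
Literature.ModelTheory.FiniteModelTheory.CPTCardDefinable C) ∧ (¬
Literature.ModelTheory.FiniteModelTheory.CPTCardDefinable {A :
Literature.ModelTheory.FiniteModelTheory.FinGraph | A.2.IsHamiltonian})`

## Assembly
Pure logic plus tree theorems (sorry-free in the planner's Sketch.lean and glue.lean, standard
axioms): from ChoicelessCapturesP and
HamNotChoiceless the Hamiltonian class — isomorphism-closed by `isIsoClosed_isHamiltonian`
(CountingWidth.lean) — is not a PTIME class, i.e.
(definitionally, `graphClassLanguage {Ham} = HAMCIRCUIT` by rfl) `HAMCIRCUIT ∉ Classes.P`; with the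
support item HamCircuitInNP
(`HAMCIRCUIT ∈ Nondeterministic.NP`, KNOWN and PROVED in the tree as `HAMCIRCUIT_mem_NP`,
HamCircuitNP.lean) and the proved, conjecture-free
model bridges `CookBridges.np_bool_eq`, `p_bool_eq` (CookBridges.lean) this is `∃ L ∈ PNPWave0.NP
Bool, L ∉ PNPWave0.P Bool` = PneNP. The
deciding theorem `closes (hU : ChoicelessCapturesP) (hL : HamNotChoiceless) (hN : HamCircuitInNP) :
PneNP` is that argument (13 lines); the
assembly item records `ChoicelessCapturesP → HamNotChoiceless → PneNP` and is provable now (`fun hU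
hL => closes hU hL HAMCIRCUIT_mem_NP` in a
Theorems file importing HamCircuitNP).
ROUTE-REPAIR 2026-08-17 (cone guardrail, rev 1): rev 0 imported HamCircuitNP, NPBridge and
ClayProblem, whose module cone (130 modules) carries the
OPEN conjecture `Literature.Computability.Complexity.NPNotSubsetPPoly` (ClayProblem.lean; reached
also via HamCircuitNP → CanonicalCodes →
NegCNFTranscoder → CookLevinSAT → CookLevin → ClayProblem) — a fact this route never uses — so the
staffing guardrail served no provers although
the ledger's constant cone (97 constants) was clean. Rev 1 drops those three imports, adds the
conjecture-free CookBridges (module cone 130 → 36,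
unproved facts 1 → 0), moves `HAMCIRCUIT ∈ NP` from inside `closes` to the by-name support item
HamCircuitInNP, and weakens nothing: cruxes 2–3
and both supports are byte-identical, `closes` still concludes `PneNP` from the route's own items
only.
IMPORT HYGIENE (standing rule for this route): the route file imports only fact-clean modules —
CPTCardProgram, CountingWidth, KarpProblems,
CookBridges (+ Summits.PneNP.Statement); Theorems files proving items (e.g. HamCircuitInNP from
HamCircuitNP.lean, the Assembly) may import
anything, but no module whose import cone reaches ClayProblem / ClayProblemProofs / NPBridge /
HamCircuitNP / CookLevin* may be added to the
route file itself.

Rationale: WHY THIS LINE. Mechanism (Gurevich 1988 §1; BGS 1999 Thm 1–2; Grohe 2008 pp. 2–4; Grädel–Grohe,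
doi:10.1007/978-3-319-23534-9_11 §7): a logic that captures P
turns "SAT ∉ P" into a DEFINABILITY statement about programs that are symmetric objects over the
input's atoms; CPT+Card is "the one major
remaining candidate" after rank logic fell (Lichter, arXiv:2104.12999; Lichter–Schweitzer,
arXiv:2205.14003 §1), and its definable queries are
provably in P (tree theorem `CPTCardInPTIME_holds`, the full PTIME simulation of bounded BGS
programs) — so with X₁ the summit is exactly X₂,
a statement for which finite model theory owns tools the Turing-machine formulation lacks: supports
and orbits of hereditarily finite sets
(BGS 1999 §8 support theorem; Dawar–Richerby–Rossman 2008 Thm 40), symmetric-circuit translations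
(Pago, arXiv:2302.05426, arXiv:2107.03778),
and counting width, whose FPC shadow of X₂ — Hamiltonicity has LINEAR counting width — is the tree's
vendored fact
`AtseriasDawarOchremiak2021_hamiltonicity_countingWidth` (arXiv:1901.07825 Lemma 14;
Dawar–Wilsenach, doi:10.4086/toc.2025.v021a014 §2.4)
and already yields 2^{Ω(n)} lower bounds for SYMMETRIC threshold circuits (Anderson–Dawar,
arXiv:1401.1125). Imported area: finite model
theory / descriptive complexity (Mathlib-typed in Literature.ModelTheory.FiniteModelTheory). What no
listed route does: Descriptive bets the
OPPOSITE horn of Grohe's dichotomy (no logic captures P; CFI ∉ CPT+Card),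
SymmetryBudget/ConvexRankGates/DescentTower posit capture by
circuit or refuter classes of their own making; this is the only line that USES the field's standing
candidate logic positively, with both
halves typed over a construction whose ⊆ P direction is already a tree theorem, and with the
deciding theorem proved (glue: iso-closure of
Hamiltonicity + the known support HamCircuitInNP (`HAMCIRCUIT_mem_NP`) + the conjecture-free
Cook/Karp class bridges of CookBridges.lean). The cut S ⇐ X₁ ∧ X₂ is non-degenerate: X₁ is
independent of S
(neither direction known), X₂ is a proved CONSEQUENCE of S (Sketch `hamNotChoiceless_of_pneNP`) that
does not give S back without X₁.

RANKED CRUXES. #2 ChoicelessCapturesP (crux) — CPT+Card captures P on finite graphs: every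
isomorphism-closed class of finite graphs whose language of adjacency codes is in P is decided
(members accepted, non-members rejected) by some PTime-bounded BGS program with counting (BGS 1999
§5.1 / 2002 §2; the Blass–Gurevich–Shelah question in the interface-free form of
`IsCPTCard.capturesPTIME_iff`). [difficulty: open-problem] (why it might fail: one iso-closed PTIME
graph class outside CPT+Card kills it — the standing candidate is the CFI query over UNORDERED base
graphs (Descriptive's crux DescriptiveCfiNotCpt; Pago arXiv:2302.05426 kills super-symmetric
programs); BGS 2002 §7 themselves call a negative answer "even more likely".) [arXivmath9705225,
BlassGurevichShelah2002, Grohe2008, DawarRicherbyRossman2008, arXiv:2205.14003, arXiv:2302.05426,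
arXiv:2010.12182]
#3 HamNotChoiceless (crux) — Hamiltonicity is not choiceless: no PTime-bounded BGS program with
counting decides the class of Hamiltonian finite graphs (an NP query outside CPT+Card — Grohe 2008
Problem 4 and its remark; its FPC shadow, linear counting width of Hamiltonicity, is
Atserias–Dawar–Ochremiak 2021 Lemma 14, vendored in the tree). A consequence of the Statement
(proved in the planner's Sketch from `CPTCardInPTIME_holds` + `HAMCIRCUIT_isNPHard`), used toward it
jointly with crux 2. [difficulty: open-problem] (why it might fail: false only if P = NP (a CPT+Card
program for HAM puts HAMCIRCUIT in P via CPTCardInPTIME_holds); the risk is unprovability: no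
lower-bound technique for full CPT+Card exists (DRR 2008 / Pago reach only rank-restricted or
super-symmetric fragments), and under crux 2 it carries all of P ≠ NP.) [Grohe2008,
AtseriasDawarOchremiak2021, DawarWilsenach2025, DawarRicherbyRossman2008, arXiv:2302.05426,
arXiv:2401.07147, arXiv:1401.1125]
#9 CaptureFromCanonisation (support) — CAPTURE FROM CANONISATION (the Immerman–Vardi half of crux 2;
BGS 1999 Thm 2 / §7 in HF-coded form; Lichter–Schweitzer 2022 §1 "almost all capturing results
define canonisation inside the logic"): if ONE PTime-bounded BGS program with counting outputs, on
every finite graph G, the atom-free HF-code (Kuratowski pairs of von Neumann ordinals) of an ordered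
isomorphic copy H of G on {0,…,n−1}, then every isomorphism-closed PTIME class is CPT+Card-definable
(simulate the class's polynomial-time machine on the code). Stub 2 of crux 2's birth skeleton; XL
formalisation (IFP/TM simulation inside BGS terms), mathematically standard. [difficulty: XL]
[arXivmath9705225, arXiv:2205.14003, arXiv:2010.12182]
#9 HamInterpretsThreeCol (support) — Hamiltonicity interprets 3-colourability choicelessly:
CPT+Card-definability of the Hamiltonian class yields CPT+Card-definability of the 3-colourable
class — closure of bounded BGS programs under the quantifier-free graph interpretation 3-COL →
(3-SAT →) HAM with clique-arranged variable gadgets (the interpretation of Atserias–Dawar–Ochremiak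
2021 Lemmas 13–14; closure under interpretations BGS 1999 §6). Stub 2 of crux 3's birth skeleton
(stub 1 = the sibling open statement "3-colourability is not CPT+Card-definable", a foreseen layer-2
child). [difficulty: L] [AtseriasDawarOchremiak2021, arXivmath9705225, AtseriasDawar2019]
#9 HamCircuitInNP (support) — KNOWN, already PROVED in the tree
(`Literature.Computability.Complexity.HAMCIRCUIT_mem_NP`, HamCircuitNP.lean; Karp 1972 problem 10,
certificate = the cycle; Arora–Barak 2009 §2.1 Ex. 2.2): Karp's HAMILTONIAN CIRCUIT language
(adjacency-matrix codes of graphs on Fin n with a Hamiltonian cycle, `HAMCIRCUIT =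
encodingGraph.toLanguage hamCircuitSet`, KarpProblems.lean) is in `Nondeterministic.NP`. The third
hypothesis of `closes`; filed as an ITEM rather than invoked inside `closes` (route-repair
2026-08-17) so that the route FILE does not import HamCircuitNP, whose module cone reaches
ClayProblem.lean and its open conjecture NPNotSubsetPPoly. A prover closes it in one line — `theorem
choicelessCapture_hamCircuitInNP_proof : ChoicelessCapture.HamCircuitInNP :=
Literature.Computability.Complexity.HAMCIRCUIT_mem_NP` — in a Theorems file importing the route file
and Literature.Computability.Complexity.HamCircuitNP (candidate attached as evidence). [difficulty:
provable-now] [Karp1972, AroraBarakCC2009, Literature.Computability.Complexity.HAMCIRCUIT_mem_NP]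

TWO-LAYER PLAN. Foreseen glued splits (nothing filed now; both birth skeletons compile with sorries
only in the stubs): ChoicelessCapturesP ⇐
ChoicelessCanonisation (∃ one bounded program outputting an atom-free HF-code of an ordered
isomorphic copy of every finite graph — the research
half; known for bounded colour classes with abelian/dihedral colours, arXiv:2010.12182, and under
CPT+WSC from definable isomorphism,
arXiv:2205.14003) → CaptureFromCanonisation (support) → ChoicelessCapturesP (glue proved: `fun hcap
hcan => hcap hcan`). HamNotChoiceless ⇐
HamInterpretsThreeCol (support) → ThreeColNotChoiceless (¬ CPTCardDefinable {A | A.2.Colorable 3},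
open) → HamNotChoiceless (glue proved).
Alternative child of crux 3 via the printed proof-complexity sufficient condition: superpolynomial
size for Aut(G)×Aut(H)-SYMMETRIC IPS_LIN
refutations of the isomorphism equations of a Hamiltonian/non-Hamiltonian pair sequence
(Dawar–Grädel–Kullmann–Pago, arXiv:2504.16820 Thm 12(2),
Thm 22; the 2001 archive's upheld Thms 10.5/10.13 on symmetric IPS degree of CFI equations are
rungs) — filed only once IPS symmetry is typed.

KILL CRITERIA. Refutation of ChoicelessCapturesP — ANY isomorphism-closed polynomial-time class of
finite graphs proved non-CPT+Card-definable (e.g.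
Descriptive's crux DescriptiveCfiNotCpt together with the iso-closure / PTIME facts for cfiQuery, or
a Pago-type theorem for all programs) —
closes the route `refuted:ChoicelessCapturesP` (and is itself the celebrated theorem CPT+Card ≠ P).
A refutation of HamNotChoiceless is a
CPT+Card program for Hamiltonicity, hence HAMCIRCUIT ∈ P and P = NP: it decides the summit
negatively. A capturing theorem for a DIFFERENT
logic (CPT+WSC, arXiv:2205.14003; an accepted version of Schewe's ICPT claim, arXiv:2005.04598)
forces a pivot: restate both cruxes for that
logic (new items, same glue shape). Gurevich's conjecture proved (route Descriptive) moots the route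
(P ≠ NP follows there directly) and
refutes crux 2.

NOT DECOMPOSED YET. The research half of crux 2 (ChoicelessCanonisation) and the sibling of crux 3
(ThreeColNotChoiceless) are typed in the birth skeletons
but not filed (thin route, D-0019); the support-size / orbit normal forms for bounded programs (DRR
2008 §8, Pago 2021) that any proof of crux 3
would start from are lemma-level (`--supports HamNotChoiceless`); symmetric-IPS vocabulary for the
alternative child is a definition request
deferred until a prover asks; restricted-class capture theorems (FPC = P on excluded-minor classes,
Grohe 2017) are calibration, not items.

CHEAPEST FALSIFIER. Lookup (run 2026-08-17): is "CPT+Card = P?" already settled? No —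
Lichter–Schweitzer (arXiv:2205.14003 §1, journal 2024) "the general quest
for a PTIME-logic remains wide open … CPT, the one major remaining candidate"; Pago
(arXiv:2302.05426, arXiv:2401.07147) proves lower bounds
only for super-symmetric / bounded-support fragments; Schewe's ICPT capture claim (arXiv:2005.04598)
is an extension of CPT and unverified.
The cheapest in-tree kill is Descriptive's CFI crux: a proof of `¬ CPTCardDefinable cfiQuery` plus
`IsIsoClosed cfiQuery ∧ IsPTIMEClass
cfiQuery` refutes crux 2 by `fun hU => h (hU _ hiso hP)`; refuters should run `exact?` against the
Descriptive evidence files first.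

NUMBERS. Counting width of Hamiltonicity and of 3-colourability ≥ d·n for large n
(Atserias–Dawar–Ochremiak 2021 Lemmas 13–14, vendored); CFI needs
Ω(n) counting variables (Cai–Fürer–Immerman 1992, tree `CFI.lean`); symmetric threshold circuits for
HAM need size 2^{Ω(n)} (Anderson–Dawar
2017 via counting width); rank-restricted CPT+Card programs (set rank o(log n / log log n)) do not
decide preordered CFI (Dawar–Richerby–Rossman
2008 Thm 40 / Cor 41); CPT canonises structures with bounded abelian / dihedral colour classes
(Lichter–Schweitzer 2021).

DEFINITION REQUESTS. None needed at open: `CPTCardProgram`, `CPTCardDefinable`, `IsIsoClosed`,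
`IsPTIMEClass`, `countingWidth`, `CkEquiv` exist in
Literature.ModelTheory.FiniteModelTheory; HF ordinals/pairs exist in `HFSets`. Foreseen (not filed):
symmetric IPS_LIN refutations and
first-order/CPT interpretations between graph classes (for HamInterpretsThreeCol and the alternative
child of crux 3).

Novelty: Searches (2026-08-17): `lit search "choiceless polynomial time" --source arxiv` (12 hits: BGS
1999/2002, Lichter–Schweitzer 2205.14003 + 2010.12182, Pago 2302.05426 / 2401.07147 / 2107.03778 /
2206.05086, Lichter 2104.12999, Schewe 2005.04598, Ferrarotti–Schewe 2401.16366,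
Grohe–Schweitzer–Wiebking 2003.10935); `lit galaxy search "choiceless polynomial time" --star all`
(10 rows: Fields of Logic and Computation II/III, Bodirsky–Rydval, Schewe ICPT); `lit read
arxiv:2205.14003 --grep …` (pp. 3, 59 read: status of the quest, canonisation route); `lean search`
over the tree (CPTCardProgram, CapturingPTIME, CountingWidth, CPTCardProgramProofs:
CPTCardInPTIME_holds); `ledger negatives --problem PneNP` (5, none on definability); hub cards grep
choiceless/CPT (grohe-absolute-walls-w-not-a, symmetric-hidden-order-window, asser-ash-type-count,
canonisation-cliff-symmetry-budget — all on the NON-capture side); 2001 archive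
pnp/routes/sat-vs-choiceless-polynomial-time (brief steps 1, 6, 7: alternative (α) named, never
typed; archive worked only on symmetric-IPS rungs, v13 upheld). The local lit daemon was down
(ConnectionReset) and OpenAlex rate-limited during this session — searches ran on arXiv + galaxy +
the tree.
Nearest prior art found: Grohe2008 (Problem 4: refute "CPT+C captures P" / find an NP query outside
CPT+C) and Grädel–Grohe 2015 doi:10.1007/978-3-319-23534-9_11 (the programme "is polynomial time
choiceless?"); on the hub, route Descriptive (opposite horn) and the 2001 rou  [refs: 10.1007/978-3-319-23534-9_11, 2205.14003, arxiv:2205.14003, doi:10.1007/978-3-319-23534-9_11, Grohe2008]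

Barriers (technique_class: choiceless-capture, definability-lower-bounds): - technique_class: choiceless-capture, definability-lower-bounds
- Literature.Barriers.PneNP.Relativization: applies to the CONJUNCTION (X₁ ∧ X₂ ⊢ S, so a proof of
both is non-relativizing) and is relocated, not dissolved: X₂ alone is WEAKER than S (S → X₂ proved)
and is a statement about bounded BGS programs over HF(atoms), a model with no oracle slot whose
lower-bound tools (bijective pebble games, supports/orbits, symmetric circuits) are not
oracle-indifferent simulations; X₁ is a capture statement orthogonal to S. Honest: if X₁ holds, X₂
is P ≠ NP in definability costume and must be proved by non-relativizing means — the bet is that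
symmetry of choiceless programs is such a means (it already separates FPC = symmetric threshold
circuits from P).
- Literature.Barriers.PneNP.BoundedRelativization: same status as Relativization (PSPACE-oracle
collapses are invisible to the BGS model; inheritance only through the conjunction).
- Literature.Barriers.PneNP.Algebrization: same inheritance; nothing in the line arithmetises or
uses low-degree extensions; not evaded for the conjunction, vacuous for X₂ alone.
- Literature.Barriers.PneNP.NaturalProofs: does not apply in form — no circuit class, no
P/poly-constructive large property of truth tables: counting-width / pebble-game lower bounds
exhibit explicit pairs of indistinguishable structures (CFI, ADO gadgets), a non-natural,
instance-specific argument; X₂ concerns a uniform logic, not SIZE(n^k).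
- Literature.Barriers.PneNP.NaturalP

History (route lifecycle, newest last):
- 2026-08-23T22:08:25Z · DORMANT — reconciler: no traction for 6.3 d (last activity item-evidence-added at 2026-08-17T14:43:26Z); parked, not closed — `ledger route dormant route-PneNP-Choiceless (operator:999:1624431)

sub-problem: PneNP · status: dormant · opened planner-plan-lens3-PneNP-resurrect-g2-0 2026-08-17T02:23:19Z · rev 1 · ledger route-PneNP-ChoicelessCapture
GENERATED by the gate from the ledger (D-0016/17). Provers cite these decls: `theorem foo : Summit.PneNP.PneNP.Theses.ChoicelessCapture.<Decl> := …` in Summits/PneNP/PneNP/Theorems/<Name>.lean.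
-/

namespace Summit.PneNP.PneNP.Theses.ChoicelessCapture

open scoped BigOperators Topology Manifold Classical MeasureTheory ProbabilityTheory Matrix InnerProductSpace ComplexConjugate ContinuousMap
open Filter Set Function TopologicalSpace MeasureTheory

attribute [summit_statement] _root_.PneNP

open Literature.PNP

/-- item stmt-PneNP-18190 · crux · rank 2 · open · by planner
why it might fail: one iso-closed PTIME graph class outside CPT+Card kills it — the standing candidate is the CFI query over UNORDERED base graphs (Descriptive's crux DescriptiveCfiNotCpt; Pago arXiv:2302.05426 kills super-symmetric programs); BGS 2002 §7 themselves call a negative answer "even more likely".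
sources: arXivmath9705225, BlassGurevichShelah2002, Grohe2008, DawarRicherbyRossman2008, arXiv:2205.14003, arXiv:2302.05426
[crux] CPT+Card captures P on finite graphs: every isomorphism-closed class of finite graphs whose
language of adjacency codes is in P is decided (members accepted, non-members rejected) by some
PTime-bounded BGS program with counting (BGS 1999 §5.1 / 2002 §2; the Blass–Gurevich–Shelah question
in the interface-free form of `IsCPTCard.capturesPTIME_iff`). [difficulty: open-problem] -/
@[route_item "route-PneNP-ChoicelessCapture", crux]
def ChoicelessCapturesP : Prop :=
  ∀ C : Set Literature.ModelTheory.FiniteModelTheory.FinGraph, Literature.ModelTheory.FiniteModelTheory.IsIsoClosed C → Literature.ModelTheory.FiniteModelTheory.IsPTIMEClass C → Literature.ModelTheory.FiniteModelTheory.CPTCardDefinable C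

/-- item stmt-PneNP-18191 · crux · rank 3 · open · by planner
why it might fail: false only if P = NP (a CPT+Card program for HAM puts HAMCIRCUIT in P via CPTCardInPTIME_holds); the risk is unprovability: no lower-bound technique for full CPT+Card exists (DRR 2008 / Pago reach only rank-restricted or super-symmetric fragments), and under crux 2 it carries all of P ≠ NP.
sources: Grohe2008, AtseriasDawarOchremiak2021, DawarWilsenach2025, DawarRicherbyRossman2008, arXiv:2302.05426, arXiv:2401.07147
[crux] Hamiltonicity is not choiceless: no PTime-bounded BGS program with counting decides the class
of Hamiltonian finite graphs (an NP query outside CPT+Card — Grohe 2008 Problem 4 and its remark;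
its FPC shadow, linear counting width of Hamiltonicity, is Atserias–Dawar–Ochremiak 2021 Lemma 14,
vendored in the tree). A consequence of the Statement (proved in the planner's Sketch from
`CPTCardInPTIME_holds` + `HAMCIRCUIT_isNPHard`), used toward it jointly with crux 2. [difficulty:
open-problem] -/
@[route_item "route-PneNP-ChoicelessCapture", crux]
def HamNotChoiceless : Prop :=
  ¬ Literature.ModelTheory.FiniteModelTheory.CPTCardDefinable {A : Literature.ModelTheory.FiniteModelTheory.FinGraph | A.2.IsHamiltonian}

/-- item stmt-PneNP-18192 · support · rank 9 · open · by planner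
sources: arXivmath9705225, arXiv:2205.14003, arXiv:2010.12182
[support] CAPTURE FROM CANONISATION (the Immerman–Vardi half of crux 2; BGS 1999 Thm 2 / §7 in
HF-coded form; Lichter–Schweitzer 2022 §1 "almost all capturing results define canonisation inside
the logic"): if ONE PTime-bounded BGS program with counting outputs, on every finite graph G, the
atom-free HF-code (Kuratowski pairs of von Neumann ordinals) of an ordered isomorphic copy H of G on
{0,…,n−1}, then every isomorphism-closed PTIME class is CPT+Card-definable (simulate the class's
polynomial-time machine on the code). Stub 2 of crux 2's birth skeleton; XL formalisation (IFP/TM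
simulation inside BGS terms), mathematically standard. [difficulty: XL] -/
@[route_item "route-PneNP-ChoicelessCapture"]
def CaptureFromCanonisation : Prop :=
  (∃ P : Literature.ModelTheory.FiniteModelTheory.CPTCardProgram, ∀ G : Literature.ModelTheory.FiniteModelTheory.FinGraph, ∃ l : ℕ, l ≤ P.stepBound.eval G.1 ∧ P.prog.HaltsAt G.2 l ∧ (P.prog.activeSet G.2 l).encard ≤ ((P.activeBound.eval G.1 : ℕ) : ℕ∞) ∧ ∃ H : SimpleGraph (Fin G.1), Nonempty (G.2 ≃g H) ∧ (P.prog.stateAt G.2 l).output = Literature.ModelTheory.FiniteModelTheory.HF.ofFinset ((Finset.univ.filter fun p : Fin G.1 × Fin G.1 => H.Adj p.1 p.2).image fun p => Literature.ModelTheory.FiniteModelTheory.HF.pair (Literature.ModelTheory.FiniteModelTheory.HF.pair (Literature.ModelTheory.FiniteModelTheory.HF.ordinal p.1.val) (Literature.ModelTheory.FiniteModelTheory.HF.ordinal p.1.val)) (Literature.ModelTheory.FiniteModelTheory.HF.pair (Literature.ModelTheory.FiniteModelTheory.HF.ordinal p.1.val) (Literature.ModelTheory.FiniteModelTheory.HF.ordinal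 p.2.val)))) → ChoicelessCapturesP

/-- item stmt-PneNP-18193 · support · rank 9 · open · by planner
sources: AtseriasDawarOchremiak2021, arXivmath9705225, AtseriasDawar2019
[support] Hamiltonicity interprets 3-colourability choicelessly: CPT+Card-definability of the
Hamiltonian class yields CPT+Card-definability of the 3-colourable class — closure of bounded BGS
programs under the quantifier-free graph interpretation 3-COL → (3-SAT →) HAM with clique-arranged
variable gadgets (the interpretation of Atserias–Dawar–Ochremiak 2021 Lemmas 13–14; closure under
interpretations BGS 1999 §6). Stub 2 of crux 3's birth skeleton (stub 1 = the sibling open statement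
"3-colourability is not CPT+Card-definable", a foreseen layer-2 child). [difficulty: L] -/
@[route_item "route-PneNP-ChoicelessCapture"]
def HamInterpretsThreeCol : Prop :=
  Literature.ModelTheory.FiniteModelTheory.CPTCardDefinable {A : Literature.ModelTheory.FiniteModelTheory.FinGraph | A.2.IsHamiltonian} → Literature.ModelTheory.FiniteModelTheory.CPTCardDefinable {A : Literature.ModelTheory.FiniteModelTheory.FinGraph | A.2.Colorable 3}

/-- item stmt-PneNP-18472 · support · rank 9 · open · by planner
sources: Karp1972, AroraBarakCC2009, Literature.Computability.Complexity.HAMCIRCUIT_mem_NP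
[support — KNOWN, already PROVED in the tree as
`Literature.Computability.Complexity.HAMCIRCUIT_mem_NP` (HamCircuitNP.lean); Karp 1972 problem 10
(certificate = the cycle); Arora–Barak 2009 §2.1] Karp's HAMILTONIAN CIRCUIT language (`HAMCIRCUIT =
encodingGraph.toLanguage hamCircuitSet`, adjacency-matrix codes of graphs on Fin n with a
Hamiltonian cycle, KarpProblems.lean) is in `Nondeterministic.NP`. Third hypothesis of the deciding
theorem `closes`; filed as an ITEM rather than invoked inside `closes` (route-repair 2026-08-17,
cone guardrail) so that the route FILE does not import HamCircuitNP, whose module cone reaches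
ClayProblem.lean and its open conjecture NPNotSubsetPPoly. Prover: one line, `theorem
choicelessCapture_hamCircuitInNP_proof : Summit.PneNP.PneNP.Theses.ChoicelessCapture.HamCircuitInNP
:= Literature.Computability.Complexity.HAMCIRCUIT_mem_NP`, in
Summits/PneNP/PneNP/Theorems/ChoicelessCaptureHamCircuitInNP.lean importing the route file and
Literature.Computability.Complexity.HamCircuitNP (candidate attached as evidence). [difficulty:
provable-now] -/
@[route_item "route-PneNP-ChoicelessCapture", crux]
def HamCircuitInNP : Prop :=
  Literature.Computability.Complexity.HAMCIRCUIT ∈ Literature.Computability.Complexity.Nondeterministic.NP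

/-- item stmt-PneNP-18194 · assembly · rank 1 · open · by planner
sources: arXivmath9705225, Karp1972, CookClay2006
[assembly] ChoicelessCapturesP → HamNotChoiceless → PneNP. -/
@[route_item "route-PneNP-ChoicelessCapture"]
def Assembly : Prop :=
  ChoicelessCapturesP → HamNotChoiceless → _root_.PneNP

/-! D-0027 §2.1 — DECIDING THEOREM (planner-authored via `route open/edit --closes-file`; by planner-rrepair-PneNP-ChoicelessCapture-a314a534-0 2026-08-17T02:37:46Z):
its hypotheses are this route's items and its conclusion the sub-problem Statement (glue_lint), and it elaborates with this file. -/

@[closes "route-PneNP-ChoicelessCapture"] theorem closes (hU : ChoicelessCapturesP) (hL : HamNotChoiceless) (hN : HamCircuitInNP) : _root_.PneNP := by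
  classical
  have hnotP : ¬ Literature.ModelTheory.FiniteModelTheory.IsPTIMEClass
      {A : Literature.ModelTheory.FiniteModelTheory.FinGraph | A.2.IsHamiltonian} :=
    fun hP => hL (hU _ Literature.ModelTheory.FiniteModelTheory.isIsoClosed_isHamiltonian hP)
  have hHam : Literature.Computability.Complexity.HAMCIRCUIT ∉
      Literature.Computability.Complexity.Classes.P := hnotP
  have hNP : Literature.Computability.Complexity.HAMCIRCUIT ∈
      Literature.Computability.Complexity.Nondeterministic.NP := hN
  show ∃ L : Language Bool, L ∈ Literature.Computability.Complexity.PNPWave0.NP Bool ∧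
      L ∉ Literature.Computability.Complexity.PNPWave0.P Bool
  refine ⟨Literature.Computability.Complexity.HAMCIRCUIT, ?_, ?_⟩
  · rw [Literature.Computability.Complexity.CookBridges.np_bool_eq]
    exact hNP
  · rw [Literature.Computability.Complexity.p_bool_eq]
    exact hHam

end Summit.PneNP.PneNP.Theses.ChoicelessCapture
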